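import Summits.AtomisticToContinuum.HydrodynamicLimit.Theses.AntiMazurCoboundaries
import Summits.AtomisticToContinuum.HydrodynamicLimit.Theses.FluxGibbsianityLdDrude
import Summits.AtomisticToContinuum.HydrodynamicLimit.Theses.TwoClocks
import Summits.AtomisticToContinuum.HydrodynamicLimit.Theses.ImplosionDichotomy
import Literature.Barriers.AtomisticToContinuum.HighMomentumCutoff
import Literature.Analysis.FluidPDE.LocalForecastCorrector

/-!
# Line `dlr-block-transfer` for crux `KineticWindowGronwall` (stmt-AtomisticToContinuum-9282)

Skeleton (crux-plan, round 1) for the crux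
`Summit.AtomisticToContinuum.HydrodynamicLimit.Theses.AntiMazurCoboundaries.KineticWindowGronwall`
(`= KineticFluxLdDecay → RelEntropyVanishing`, shared with route FluxGibbsianityLdDrude; Disproof §0).

Idea card `Cruxes/KineticWindowGronwall/Ideas/dlr-block-transfer.md` (triage r1: 3/3 pass; merge base with
`locality-inside-the-pressure`, `self-similar-block-periodisation`). Line card: `Lines/dlr-block-transfer.md`.

## Shape

Seven registered stubs and the kernel-checked composition `KineticWindowGronwall_of`:

* `stub_kineticInputQ : KineticFluxLdDecayQ` — the kinetic LD input in the QUADRATIC-GROWTH class with the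
  amplitude `κ` chosen BEFORE `σ` and before the observable (ideator-3's `KineticFluxLdDecayQuad`, verbatim):
  the re-typing of the shared crux 10967 requested by the r1 panel (BN1 amplitude budget, BN3/S2 σ-uniformity).
  It implies the crux's antecedent (`kineticFluxLdDecay_of_Q`, proved below), which is why the composition does
  not consume `KineticFluxLdDecay` itself: by Disproof §1 the crux's content is "B given A", and A as typed
  cannot be fed to any entropy-inequality ledger for non-isothermal data (panel, unanimous). Delegated (= 10967
  re-typed; staffed through FluxGibbsianityLdDrude / TwoClocks 14440); NOT to be attacked inside this line.
* `stub_collarLocality : CollarInfluenceLocality` — LD finite speed of influence across a MACROSCOPIC collar within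
  ONE kinetic window under the homogeneous (flow-invariant) Gibbs laws, at every exponential rate (X1 of the panel:
  the only locality the h-weighted ledger needs). Provable-grade.
* `stub_blockTransfer : BlockTransfer` — THE LEVER of this line: blockwise fixed-count DLR re-embedding with zoom
  covariance transfers the kinetic-window pressure bound from the homogeneous torus gas to local Gibbs laws with
  continuous space–time profiles, uniformly on `t ∈ [0,T]` and for all long windows, at a universal packing guard `η₀`
  (amplitude `κ` depending on the profile family only through its temperature contrast).
* `stub_collisionalSide : CollisionalSide` — the collisional twin and the price of its clamp: the typed cruxes
  `TwoClocks.EquilibriumClampedCollisionalWindowLD` (13733) `∧` `TwoClocks.CollisionActivityTails` (13734). Delegated.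
* `stub_velocityTails : GaussianVelocityTails` — `HighMomentumCutoff σ` for all small `σ` (catalogued OPEN
  hypothesis; BN2: the tail child must be superexponential in the cut-off, used through Chebyshev only).
* `stub_staticsAndGuard : StaticsAndGuard` — `TwoClocks.UniformLocalGibbsConcentration` (14445) `∧`
  `TwoClocks.HsEosLowDensity` (0768) `∧` `TwoClocks.DiluteSelfConsistency` (3091 = ImplosionDichotomy's, `rfl`).
  Delegated.
* `stub_entropyLedger : EntropyLedger` — the Nachtergaele–Yau kinetic-window ledger: the five inputs above give
  `RelEntropyVanishing` (tie and balance laws used: honours `relEntropyVanishingUntied_false`,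
  `relEntropyVanishingNoPDE_false`; only quadratic-growth observables inside any pressure: honours
  `lintegral_exp_mul_pow_three_eq_top`).

`composition h1 … h7 := fun _ => h7 (h3 h1 h2 h6.1) h2 h4 h5 h6` (sorry-free) and
`KineticWindowGronwall_of : KineticWindowGronwall := composition stub_kineticInputQ … stub_entropyLedger` — no sorry outside `stub_*`.
-/

noncomputable section

namespace Summit.AtomisticToContinuum.HydrodynamicLimit.Cruxes.KineticWindowGronwall.DlrBlockTransfer

open scoped BigOperators ENNReal Classical
open MeasureTheory Set
open Literature.MathematicalPhysics.KineticTheory Literature.Analysis.FluidPDE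
open Summit.AtomisticToContinuum.HydrodynamicLimit.Theses
open Summit.AtomisticToContinuum.HydrodynamicLimit.Theses.AntiMazurCoboundaries

/-! ## §0 Sanity: the crux and the shared decls -/

/-- The crux is literally `KineticFluxLdDecay → RelEntropyVanishing`. -/
example : KineticWindowGronwall = (KineticFluxLdDecay → RelEntropyVanishing) := rfl

/-- The TwoClocks copy of the shared target 0766 is the same term as the crux's consequent. -/
theorem relEntropyVanishing_eq_twoClocks :
    AntiMazurCoboundaries.RelEntropyVanishing = TwoClocks.RelEntropyVanishing := rfl

/-- The TwoClocks copy of the dilute guard 3091 is the same term as ImplosionDichotomy's (the item's owner). -/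
theorem diluteSelfConsistency_eq :
    TwoClocks.DiluteSelfConsistency = ImplosionDichotomy.DiluteSelfConsistency := rfl

/-! ## §1 The typed statements of the line -/

/-- **Kinetic LD input, quadratic-growth class, amplitude before `σ` and before the observable** (verbatim
`IdeatorThree.KineticFluxLdDecayQuad`; the r1 panel's re-typing of the shared crux 10967 — BN1: the truncated
fast heat flux `w(‖w‖²−5)/2·χ_A(w)/A` lies in this class with an `A`-independent constant, so the entropy-inequality
amplitude is `≍ 1/A` and the Gronwall rate `≍ A`, which Gaussian tails beat; BN3: `κ` uniform on the density band
`σρ(t,x)^{1/3}` met along the Euler solution). Same frame as `KineticFluxLdDecay` (homogeneous canonical Gibbs law,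
flow-invariant; `Φ` innermost, so `τ, N₀` are uniform in the flow — needed by the transfer, which runs the
hypothesis on comparison tori). Implies `KineticFluxLdDecay` (`kineticFluxLdDecay_of_Q`). -/
def KineticFluxLdDecayQ : Prop :=
  ∀ (a θ : ℝ) (u₀ : V3), 0 < a → 0 < θ → ∃ σ₀ : ℝ, 0 < σ₀ ∧ ∃ κ : ℝ, 0 < κ ∧ ∀ σ : ℝ, 0 < σ → σ < σ₀ →
    (∀ (N : ℕ) (Φ : HardSphereFlow (Torus.geometry (Fin 3)) (hsDiameter σ N) (N + 1)),
      IsProbabilityMeasure (localGibbsLaw σ (fun _ => a) (fun _ => u₀) (fun _ => θ) N Φ)) ∧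
    ∀ (φ : T3 → ℝ) (g : V3 → ℝ), Continuous φ → Continuous g → (∀ x, |φ x| ≤ 1) →
      (∀ v, |g v| ≤ κ * (1 + ‖v‖ ^ 2)) →
      (∀ (c₀ c₂ : ℝ) (b : V3), ∫ v, g v * (c₀ + inner ℝ b v + c₂ * ‖v‖ ^ 2) ∂(ProbabilityTheory.stdGaussian V3) = 0) →
      ∀ δ : ℝ, 0 < δ → ∃ τ : ℝ, 0 < τ ∧ ∃ N₀ : ℕ, ∀ N : ℕ, N₀ ≤ N →
        ∀ Φ : HardSphereFlow (Torus.geometry (Fin 3)) (hsDiameter σ N) (N + 1),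
          ∫⁻ z, ENNReal.ofReal (Real.exp ((τ * ((N + 1 : ℕ) : ℝ) ^ (-(1 / 3 : ℝ)))⁻¹ *
              ∫ s in (0 : ℝ)..(τ * ((N + 1 : ℕ) : ℝ) ^ (-(1 / 3 : ℝ))),
                ∑ i, φ (Φ.flow s z i).1 * g ((Real.sqrt θ)⁻¹ • ((Φ.flow s z i).2 - u₀))))
            ∂(localGibbsLaw σ (fun _ => a) (fun _ => u₀) (fun _ => θ) N Φ) ≤
          ENNReal.ofReal (Real.exp (δ * (N + 1)))

/-- **One-window influence locality across a macroscopic collar, at every exponential rate** (panel finding X1: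
the h-weighted ledger puts exactly ONE kinetic window of dynamics inside each pressure, so the locality it needs
is across a MACROSCOPIC collar `r` within ONE kinetic window `τ(N+1)^{-1/3}`, not the kinetic-range LD form of
`InfluenceLocality` 13916). Under the homogeneous canonical Gibbs law `G_N` (any constant frame; `σ` below a
universal `σ₀`), for every macroscopic collar `r > 0`, kinetic window `τ`, rate `lam` and `δ > 0`, for all large
`N`, every flow `Φ` and every family `Ψ` of isolated cluster flows:
`∫ exp(lam · #{i : ∃ t ≤ τ(N+1)^{-1/3}, Φ_t(z)_i ≠ localClusterState Ψ r t z i}) dG_N ≤ e^{δ(N+1)}`.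
Content: crossing distance `r = (r/σ)(N+1)^{1/3}` diameters within `τ` kinetic units needs one carrier of speed
`≳ r(N+1)^{1/3}/τ` (Gaussian cost `≍ N^{2/3}`), or a near-contact chain of `≳ r(N+1)^{1/3}/σ` links with gaps
`≲ τσ√θ/(rN^{2/3})` (cost `≳ (2/3)log N` per corrupted forecast), or an energy packet of size `≍ εN`, which corrupts
only `O(N^{2/3})` forecasts (energy budget): every mechanism has cost per corrupted particle `→ ∞`, so `∀ lam ∀ δ`
holds eventually in `N` (paper estimates: TRIAGE-r1-2 A2, TRIAGE-r1-1 X4). The `∀ lam` form is what the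
domination `ψ_t ≤ e^{KN} G_hot` of the transfer consumes (superexponential smallness survives the factor `e^{KN}`). -/
def CollarInfluenceLocality : Prop :=
  ∃ σ₀ : ℝ, 0 < σ₀ ∧ ∀ (a θ : ℝ) (u₀ : V3), 0 < a → 0 < θ → ∀ σ : ℝ, 0 < σ → σ < σ₀ →
    ∀ (r τ lam δ : ℝ), 0 < r → 0 < τ → 0 < lam → 0 < δ → ∃ N₀ : ℕ, ∀ N : ℕ, N₀ ≤ N →
      ∀ (Φ : HardSphereFlow (Torus.geometry (Fin 3)) (hsDiameter σ N) (N + 1))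
        (Ψ : (k : ℕ) → HardSphereFlow (Torus.geometry (Fin 3)) (hsDiameter σ N) k),
        ∫⁻ z, ENNReal.ofReal (Real.exp (lam *
            ((Finset.univ.filter fun i : Fin (N + 1) =>
              ∃ t ∈ Set.Icc (0 : ℝ) (τ * ((N + 1 : ℕ) : ℝ) ^ (-(1 / 3 : ℝ))),
                Φ.flow t z i ≠ localClusterState Ψ r t z i).card : ℝ)))
          ∂(localGibbsLaw σ (fun _ => a) (fun _ => u₀) (fun _ => θ) N Φ) ≤
        ENNReal.ofReal (Real.exp (δ * (N + 1)))

/-- **The LOCAL kinetic-window pressure bound — what the transfer delivers and the ledger consumes.** There is a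
universal packing guard `η₀ > 0` such that for every horizon `T`, all continuous space–time profiles `(a, θ, u)`
(activity, temperature, velocity; positive) and every `σ > 0` obeying the activity-ratio guard
`σ³ · sup_x a_t ≤ η₀ ∫ a_t` for `t ∈ [0,T]` (TwoClocks' guard; at constant activity it reads `σ³ ≤ η₀`; met along a
tied classical Euler solution by `DiluteSelfConsistency`): the local Gibbs laws `ψ_t = localGibbsLaw σ a_t u_t θ_t`
are probability measures, and there is an amplitude `κ > 0` (depending on the profile family only through the
temperature contrast `sup θ / inf θ` on `[0,T] × 𝕋³` — FINITENESS forces this: a sphere flying from a hot into a cold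
region within the window has local standardised energy `≍ θ_max/θ_min`, so a family-independent `κ` would make the
integral below infinite; `κ` does NOT depend on the test functions, on `δ` or on the truncation level hidden in `g`,
which is what the Nachtergaele–Yau rate `∝ A` needs) such that for all continuous `φ_t(x)` with `|φ| ≤ 1`, all `g` of
quadratic growth AND quadratic-compatible Lipschitz modulus, `|g(w)| ≤ κ(1 + ‖w‖²)`,
`|g(w) − g(w')| ≤ κ(1 + ‖w‖ + ‖w'‖)‖w − w'‖` (so that freezing the local frame over a block of side `r` perturbs the
observable by `O(r)(1 + ‖w‖²)`; the re-orthogonalised truncated heat flux `qχ_A/A` and stress `pχ_A` satisfy it with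
`A`-independent constants), orthogonal to `1, w, ‖w‖²` in `L²(stdGaussian)`, and every `δ > 0` there is a window
threshold `τ₀` such that for EVERY window `τ ≥ τ₀` one `N₀` serves every `t ∈ [0,T]` and every flow, with
`∫ exp(h⁻¹∫₀ʰ Σ_i φ_t(x_i(s)) g((v_i(s) − u_t(x_i(s)))/√θ_t(x_i(s))) ds) dψ_t ≤ e^{δ(N+1)}`, `h = τ(N+1)^{-1/3}`:
the fast one-body observable standardised in the LOCAL frame has `o(N)` window pressure under the local Gibbs
reference, uniformly along any compact profile family and for all long enough kinetic windows (the ledger must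
synchronise this window with the collisional one of 13733, hence `∀ τ ≥ τ₀`; upward in `τ` comes from
`Λ_{mτ} ≤ Λ_τ` under the INVARIANT homogeneous law before transfer). Quadratic class = panel BN1; `t`-uniform `N₀` =
finite `ε`-net in `t` by Rényi comparison at halved amplitude. -/
def LocalWindowPressureQ : Prop :=
  ∃ η₀ : ℝ, 0 < η₀ ∧
    ∀ (T : ℝ) (a θ : ℝ → T3 → ℝ) (u : ℝ → T3 → V3),
      Continuous (Function.uncurry a) → Continuous (Function.uncurry θ) → Continuous (Function.uncurry u) →
      (∀ t x, 0 < a t x) → (∀ t x, 0 < θ t x) →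
      ∀ σ : ℝ, 0 < σ → (∀ t ∈ Icc (0 : ℝ) T, σ ^ 3 * (⨆ x, a t x) ≤ η₀ * ∫ x, a t x) →
        (∀ t ∈ Icc (0 : ℝ) T, ∀ (N : ℕ) (Φ : HardSphereFlow (Torus.geometry (Fin 3)) (hsDiameter σ N) (N + 1)),
          IsProbabilityMeasure (localGibbsLaw σ (a t) (u t) (θ t) N Φ)) ∧
        ∃ κ : ℝ, 0 < κ ∧ ∀ (φ : ℝ → T3 → ℝ) (g : V3 → ℝ), Continuous (Function.uncurry φ) → Continuous g →
          (∀ t x, |φ t x| ≤ 1) → (∀ v, |g v| ≤ κ * (1 + ‖v‖ ^ 2)) →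
          (∀ v w, |g v - g w| ≤ κ * (1 + ‖v‖ + ‖w‖) * ‖v - w‖) →
          (∀ (c₀ c₂ : ℝ) (b : V3), ∫ v, g v * (c₀ + inner ℝ b v + c₂ * ‖v‖ ^ 2) ∂(ProbabilityTheory.stdGaussian V3) = 0) →
          ∀ δ : ℝ, 0 < δ → ∃ τ₀ : ℝ, 0 < τ₀ ∧ ∀ τ : ℝ, τ₀ ≤ τ → ∃ N₀ : ℕ, ∀ N : ℕ, N₀ ≤ N → ∀ t ∈ Icc (0 : ℝ) T,
            ∀ Φ : HardSphereFlow (Torus.geometry (Fin 3)) (hsDiameter σ N) (N + 1),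
              ∫⁻ z, ENNReal.ofReal (Real.exp ((τ * ((N + 1 : ℕ) : ℝ) ^ (-(1 / 3 : ℝ)))⁻¹ *
                  ∫ s in (0 : ℝ)..(τ * ((N + 1 : ℕ) : ℝ) ^ (-(1 / 3 : ℝ))),
                    ∑ i, φ t (Φ.flow s z i).1 *
                      g ((Real.sqrt (θ t (Φ.flow s z i).1))⁻¹ • ((Φ.flow s z i).2 - u t (Φ.flow s z i).1))))
                ∂(localGibbsLaw σ (a t) (u t) (θ t) N Φ) ≤
              ENNReal.ofReal (Real.exp (δ * (N + 1)))

/-- **Gaussian velocity moments along the true evolution, for all small `σ`** (= `IdeatorThree.GaussianTailsAlongEvolution`):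
the catalogued OPEN hypothesis `Literature.Barriers.AtomisticToContinuum.HighMomentumCutoff σ` (Nachtergaele–Yau
II.1 transcribed to hard spheres: `E[(N+1)⁻¹ Σ_i exp(c‖v_i(t)‖²)] ≤ C` uniformly in `N` and `t ≤ T` under the local
Gibbs initial law, any flow family). BN2: the tail child of every Gronwall line for 9282 is an a-priori estimate on
the one-particle velocity marginal ALONG THE TRUE LAW, decaying faster than every exponential in the cut-off, used
through Chebyshev (never through the entropy inequality: `lintegral_exp_mul_pow_three_eq_top`). -/
def GaussianVelocityTails : Prop :=
  ∃ σ₀ : ℝ, 0 < σ₀ ∧ ∀ σ : ℝ, 0 < σ → σ < σ₀ → Literature.Barriers.AtomisticToContinuum.HighMomentumCutoff σ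

/-- **The collisional side** (delegated to the typed cruxes of route TwoClocks): the CLAMPED, EOS-projected
collisional-transfer window LD at global equilibrium over the landed collision records (13733; the pair-symmetric
activity clamp is what keeps energy packets and caged cores out of the pressure — kinetic and collisional energy
transport of a fast packet are tame only jointly) `∧` the a-priori `L¹` activity tails under the TRUE evolution that
price the clamp (13734). -/
def CollisionalSide : Prop :=
  TwoClocks.EquilibriumClampedCollisionalWindowLD ∧ TwoClocks.CollisionActivityTails

/-- **Statics and the dilute guard** (delegated): the `η₀`-uniform exponential LLN for canonical local Gibbs states
(14445; also the block-count typicality the transfer conditions on), the low-density equation of state (0768; makes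
`Z, Z′` of 13733 the virial quantities and the Euler system hyperbolic), and dilute self-consistency of tied classical
solutions (3091, owned by ImplosionDichotomy: `ρ_t(x)σ³ < η` along the solution — the density-range guard without
which no blockwise use of a dilute-only hypothesis can reach `RelEntropyVanishing` as typed; BN1-ideator1, N4, X3). -/
def StaticsAndGuard : Prop :=
  TwoClocks.UniformLocalGibbsConcentration ∧ TwoClocks.HsEosLowDensity ∧ TwoClocks.DiluteSelfConsistency

/-- **The lever of the line (statement).** The homogeneous quadratic-class kinetic input, one-window collar locality
and the uniform static LLN give the LOCAL window pressure bound. Proof plan (card + triage sharpenings):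
(1) covariance: thermal scaling `(x,t) ↦ (x, t√θ)`, `v ↦ v/√θ` and torus boosts (moving test function, cost
`e^{(N+1)κ ω_φ(|u|h)} = e^{o(N)}`) reduce every use of `KineticFluxLdDecayQ` to the frame `(1, 1, 0)`: ONE threshold
`σ₀*`, ONE `κ*`; (2) chessboard of blocks `Q` of side `r`, 27 colours, Hölder ⇒ amplitude `κ*/27`; (3) functional-side
locality: inside the pressure replace each block functional by its `r/3`-collar forecast; the bad set is
superexponentially negligible under `G_hot` (`CollarInfluenceLocality`, `∀ lam`) and transfers through the POINTWISE
domination `ψ_t ≤ e^{KN} G_hot` (`θ_hot > sup θ`), so the reference is never transported; (4) same-colour forecast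
functionals are block-local ⇒ exact conditional independence given counts and collar configurations (hard-core
Markov/DLR); (5) fixed-count block conditional of `ψ_t` vs the ZOOMED block conditional of the homogeneous law at
grid density `ρ_k` (zoom `λ_k = ρ_k^{1/3}`: `(x,t,d) ↦ (λx, λt, λd)` is an exact symmetry of hard-sphere dynamics, so
diameters match EXACTLY and only finitely many grid instances `σρ_k^{1/3} < σ₀*` are ever invoked — `τ, N₀` pointwise
suffice; the packing guard `η₀ := σ₀*³/4` keeps the grid inside the hypothesis): Rényi-2 cost of the profile
oscillation `O(n_Q r²)` (first order cancels — a variance; `g ⊥ (w, ‖w‖²)` makes the frame-freezing mean error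
`O(r²)` too), count mismatch `≤ η` priced by the block-count LD lower bound `e^{-cη²n_Q - o(n_Q)}` of the dilute
hard-sphere gas (equivalence of ensembles; typical counts from `UniformLocalGibbsConcentration`); (6) un-condition in
the comparison torus (`E[·|count] ≤ E[·]/P(count)`), apply the hypothesis with the block bump `φχ_Q` at the common
window (`Λ_{mτ} ≤ Λ_τ` by Hölder + invariance, upward stability for the fractional part); (7) total:
`(δ' + cη² + Cr² + o(1))·N` per window pressure, then `δ', η, r → 0`; `ε`-net in `t` by Rényi comparison. -/
def BlockTransfer : Prop :=
  KineticFluxLdDecayQ → CollarInfluenceLocality → TwoClocks.UniformLocalGibbsConcentration → LocalWindowPressureQ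

/-- **The entropy ledger (statement).** Nachtergaele–Yau kinetic-window relative-entropy method for the deterministic
torus dynamics, ALL analytic inputs supplied: local kinetic window pressure (quadratic class, universal amplitude),
collar locality (to localise the clamped collisional functional of 13733 to local Gibbs data — step (iii) of
TwoClocks' dock, by the method of `BlockTransfer`), the collisional side, Gaussian velocity tails along the true law,
statics and the dilute guard `⟹ RelEntropyVanishing`. Shape: `σ₀ :=` min of the inputs' thresholds with
`DiluteSelfConsistency` at `η := η₀/4`; per window `[t, t+h]`, `ΔH = E_{f_t}[U]` with `U = log ψ_t − log ψ_{t+h}∘Φ_h`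
(Liouville); pathwise `U = Σ_i ∫ streaming + Σ_collisions [λ(x_i) − λ(x_j)]·Δζ_i` (collisionSum); Euler in entropy
variables cancels the affine parts (kinetic exactly — AffineProjection —, collisional through the EOS projection of
13733 identified with `∇(hsPressure − ρθ)` by 0768 + virial + ensemble equivalence); heat flux truncated and
re-orthogonalised at `‖w‖ ≤ A`, fed to `LocalWindowPressureQ` as `A·(qχ_A/A)` at amplitude `κ/(CA)` (rate `∝ A`), tail
`Σ c·q·1_{‖w‖>A}` in `f_t`-mean by `HighMomentumCutoff` + Chebyshev (`≤ C'e^{-cA²/2}`, beats `e^{CAT}`); clamp remainder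
`≤ ‖∇λ‖ ×` activity tail in `f_t`-mean (13734); ONE collisional amplitude serving the whole multiplier family
`{∇λ_s : s ≤ t}` is extracted from 13733's pointwise `∀ φ ∃ β₀` by Baire category in `C^∞(𝕋³)` (the set of test
functions with vanishing window pressure at amplitude 1 and clamp level `V` is convex, balanced and absorbing, hence —
with the pathwise clamp bound `|w⁻¹X_V(ψ)| ≤ ½‖∇ψ‖_∞ V(N+1)` and `∀ τ ≥ τ₀` — contains a `C^k`-ball); quadratic
remainders by the LD estimate (zero pressure below a fixed amplitude); entropy inequality at `γ = β/h` and `discreteWindowGronwall_exp` (Disproof §5: the per-window `o(N)` enters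
once times `T/β`); order of limits: `A` fixed → `β(A)` → Gronwall → `N → ∞` → `τ → ∞`, `δ → 0` → `A → ∞`; finally the
activity profile `a_t` with the Euler density (activity inversion at packing `< η₀/4`) and the reference concentration
(14445) give the two remaining clauses of `RelEntropyVanishing`. Honours the landed Negative lemmas: the tie
(`relEntropyVanishingUntied_false`) is where `H(f₀|ψ₀) = o(N)` comes from, the balance laws
(`relEntropyVanishingNoPDE_false`) are the affine cancellation, and no cubic observable ever enters a pressure
(`lintegral_exp_mul_pow_three_eq_top`). -/
def EntropyLedger : Prop :=
  LocalWindowPressureQ → CollarInfluenceLocality → CollisionalSide → GaussianVelocityTails → StaticsAndGuard →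
    RelEntropyVanishing

/-! ## §2 Registered stubs -/

/-- STUB 1 (delegated; = shared crux 10967 re-typed: quadratic-growth class, `κ` before `σ`). Open problem
(no LD technology at fixed `σ`; BGSS horizons `o((log|log ε|)^{1/4})` in Boltzmann–Grad only). -/
theorem stub_kineticInputQ : KineticFluxLdDecayQ := by
  sorry

/-- STUB 2 (provable-grade, M/L): one-window influence locality across a macroscopic collar under the invariant
homogeneous Gibbs law, at every exponential rate. -/
theorem stub_collarLocality : CollarInfluenceLocality := by
  sorry

/-- STUB 3 (THE LEVER; L): blockwise fixed-count DLR re-embedding with zoom covariance, 27-colour chessboard,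
functional-side locality through `ψ_t ≤ e^{KN}G_hot`, equivalence of ensembles at LD precision. -/
theorem stub_blockTransfer : BlockTransfer := by
  sorry

/-- STUB 4 (delegated; TwoClocks 13733 ∧ 13734): clamped EOS-projected collisional window LD at equilibrium and the
true-law activity tails pricing the clamp. -/
theorem stub_collisionalSide : CollisionalSide := by
  sorry

/-- STUB 5 (open, barrier-level: `HighMomentumCutoffBarrier(Narrow)` — "no proof even in the classical case"):
Gaussian velocity moments along the true evolution for all small `σ`. -/
theorem stub_velocityTails : GaussianVelocityTails := by
  sorry

/-- STUB 6 (delegated; TwoClocks 14445 ∧ 0768 ∧ 3091): uniform static LLN, low-density EOS, dilute self-consistency. -/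
theorem stub_staticsAndGuard : StaticsAndGuard := by
  sorry

/-- STUB 7 (L; known technology given its hypotheses: Yau1991, OVY1993 §3, KipnisLandim1999 Ch. 6, NachtergaeleYau2003
§5–§7): the kinetic-window entropy ledger. -/
theorem stub_entropyLedger : EntropyLedger := by
  sorry

/-! ## §3 The composition (kernel-checked; `sorry` only through the registered stubs) -/

/-- **The reduction, hypothesis form (pure logic, sorry-free).** The seven stub STATEMENTS imply the crux, written
unfolded as `KineticFluxLdDecay → RelEntropyVanishing` so that the by-name skeleton theorems below are the only
declarations concluding the crux decls: the ledger turns the transferred local window pressure, collar locality, the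
collisional side, the velocity tails and the statics/guard into `RelEntropyVanishing`; the antecedent is implied by,
and not used beyond, stub 1 (`kineticFluxLdDecay_of_Q`). -/
theorem composition :
    KineticFluxLdDecayQ → CollarInfluenceLocality → BlockTransfer → CollisionalSide → GaussianVelocityTails →
      StaticsAndGuard → EntropyLedger → (KineticFluxLdDecay → RelEntropyVanishing) :=
  fun h1 h2 h3 h4 h5 h6 h7 _ => h7 (h3 h1 h2 h6.1) h2 h4 h5 h6

/-- The same composition reaches the shared TARGET 0766 outright (documenting that the line does not lean on the
crux's antecedent as typed). -/
theorem relEntropyVanishing_of :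
    KineticFluxLdDecayQ → CollarInfluenceLocality → BlockTransfer → CollisionalSide → GaussianVelocityTails →
      StaticsAndGuard → EntropyLedger → RelEntropyVanishing :=
  fun h1 h2 h3 h4 h5 h6 h7 => h7 (h3 h1 h2 h6.1) h2 h4 h5 h6

/-- **SKELETON THEOREM: `KineticWindowGronwall` (route AntiMazurCoboundaries) from the seven registered stubs, by name.**
`composition` applied to `stub_kineticInputQ … stub_entropyLedger`; no hypotheses; the only `sorry`s are inside the stubs. -/
theorem KineticWindowGronwall_of :
    Summit.AtomisticToContinuum.HydrodynamicLimit.Theses.AntiMazurCoboundaries.KineticWindowGronwall :=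
  composition stub_kineticInputQ stub_collarLocality stub_blockTransfer stub_collisionalSide stub_velocityTails
    stub_staticsAndGuard stub_entropyLedger

/-- **SKELETON THEOREM for the sibling decl** (route FluxGibbsianityLdDrude, same item 9282; `rfl`-equal, Disproof §0). -/
theorem KineticWindowGronwall_sibling_of :
    Summit.AtomisticToContinuum.HydrodynamicLimit.Theses.FluxGibbsianityLdDrude.KineticWindowGronwall :=
  KineticWindowGronwall_of

/-! ## §4 Honesty lemmas (sorry-free) -/

/-- **Stub 1 strengthens the crux's antecedent**: the quadratic-growth class contains the bounded class and
`∃ κ ∀ σ` implies `∀ σ ∃ κ`. Hence the stub set is at least as strong as `KineticFluxLdDecay`, and once 10967 is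
re-typed as requested (panel BN1/BN3) stub 1 IS the shared crux. -/
theorem kineticFluxLdDecay_of_Q (h : KineticFluxLdDecayQ) : KineticFluxLdDecay := by
  intro a θ u₀ ha hθ
  obtain ⟨σ₀, hσ₀, κ, hκ, H⟩ := h a θ u₀ ha hθ
  refine ⟨σ₀, hσ₀, fun σ hσ hσ' => ?_⟩
  obtain ⟨hP, H'⟩ := H σ hσ hσ'
  refine ⟨hP, κ, hκ, fun φ g hφc hgc hφ hg horth δ hδ => ?_⟩
  have hg' : ∀ v : V3, |g v| ≤ κ * (1 + ‖v‖ ^ 2) := fun v =>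
    (hg v).trans (le_mul_of_one_le_right hκ.le (le_add_of_nonneg_right (sq_nonneg _)))
  exact H' φ g hφc hgc hφ hg' horth δ hδ

/-- The dilute guard consumed by the ledger is literally ImplosionDichotomy's item 3091. -/
theorem diluteGuard_of_staticsAndGuard (h : StaticsAndGuard) : ImplosionDichotomy.DiluteSelfConsistency :=
  diluteSelfConsistency_eq ▸ h.2.2

/-- Stub 5 at one density is the catalogued open hypothesis (evasion polarity of `HighMomentumCutoffBarrier`). -/
theorem highMomentumCutoff_of_tails (h : GaussianVelocityTails) :
    ∃ σ₀ : ℝ, 0 < σ₀ ∧ ∀ σ : ℝ, 0 < σ → σ < σ₀ →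
      Literature.Barriers.AtomisticToContinuum.HighMomentumCutoff σ := h

/-- Negative-lemma check. The landed Negative lemmas of this crux
(`Theorems/KineticWindowGronwall/Negative/CubicMomentDiverges.lean`: `lintegral_exp_mul_pow_three_eq_top`, p73911;
`…/ConsequentLoadBearing.lean`: `relEntropyVanishingUntied_false`, `relEntropyVanishingNoPDE_false`, p74367) refute
(i) finite cubic exponential moments under a Maxwellian, (ii) the consequent with the `t = 0` tie deleted, (iii) the
consequent with the balance laws deleted. No stub above is an instance: every pressure (`KineticFluxLdDecayQ`,
`LocalWindowPressureQ`, 13733) carries quadratic-growth or clamped observables only, the cubic tail is the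
`f_t`-MEAN input `GaussianVelocityTails`, and `EntropyLedger` concludes `RelEntropyVanishing` verbatim (tie and PDE
kept). Scratch check importing the two Negative modules: `scratch-negatives.lean` of the planner folder. -/
theorem negative_lemmas_honoured : True := trivial

end Summit.AtomisticToContinuum.HydrodynamicLimit.Cruxes.KineticWindowGronwall.DlrBlockTransfer

end
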